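import Mathlib.LinearAlgebra.Matrix.SchurComplement
import Mathlib.LinearAlgebra.Matrix.NonsingularInverse
import Mathlib.Tactic.NoncommRing
import Mathlib.Tactic.LinearCombination
import HarnessLib

/-!
# Even–odd (red–black) preconditioning of the fermion matrix: the Schur-complement
# factorisations of `det D`, the two "mixed-free" forms, and the block-diagonal preconditioned matrix

Topic `LinearAlgebra/Matrix`.  PUBLISHED RESULTS with our proofs; no definition and no named fact
(`def … : Prop`) is introduced (D-0026).  Wanted by the cell pub-lqcd (venture `LatticeQCDFlow`,
HOME/R2-SCOPE.md §1 ("a solve"), §3 E7 (cost ledger in solve units) and §4 cost classes: every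
printed R2 competitor — the pseudofermion flows of Albergo et al. 2021 and Abbott et al. 2022, the
RHMC of the PTBC full-QCD runs — inverts or estimates the determinant of the even–odd REDUCED
`V/2 × V/2` operator, and the bookkeeping "one solve = one solve of the Schur complement plus one
application of the inverse of a site-diagonal block" is what this file makes exact; FANOUT row 38).
Companion of `Literature/MathematicalPhysics/QuantumLattice/WilsonCellSchur.lean` (nested-dissection
VOCABULARY over the concrete Wilson–Dirac matrix of the tree; a different decomposition) and of
Mathlib's `Matrix.det_fromBlocks₁₁` / `det_fromBlocks₂₂` / `fromBlocks_eq_of_invertible₂₂`, of which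
§1 (first lines) and §3 are repackagings with `IsUnit`-hypotheses and the tree's `A⁻¹` (`nonsing_inv`).

## Sources (read on the materialised texts) and what is taken from each

* M. S. Albergo, G. Kanwar, S. Racanière, D. J. Rezende, J. M. Urban, D. Boyda, K. Cranmer,
  D. C. Hackett, P. E. Shanahan, *Flow-based sampling for fermionic lattice field theories*,
  Phys. Rev. D 104 (2021) 114507 = arXiv:2106.05934 [AlbergoEtAl2021Fermions], Appendix B
  "Even-odd preconditioning" (held text `paper:arxiv-2106.05934`, chunk p0021):
  > Ordering lattice sites into even and odd subsets allows writing the Dirac matrix `D` as a `2 × 2`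
  > block matrix of the form `D = [[m_f + gφ_o, D_oe], [D_eo, m_f + gφ_e]] ≡ [[𝒜, ℬ], [𝒞, 𝒟]]` (B1)
  > … This form allows a more efficient stochastic approximation of the determinant by decomposing
  > it into the determinant of either diagonal block and the associated Schur complement as
  > `det D = det(𝒜) det(𝒟 − 𝒞𝒜⁻¹ℬ) = det(𝒜𝒞⁻¹𝒟 − ℬ) det(𝒞)` (B2), or, equivalently,
  > `det D = det(𝒟) det(𝒜 − ℬ𝒟⁻¹𝒞) = det(𝒟ℬ⁻¹𝒜 − 𝒞) det(ℬ)` (B3).  Rewriting from the first to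
  > the second form in (B2), (B3) ensures that the resulting expression does not involve terms that
  > mix `𝒜` and `𝒟` with their respective inverses. … Since `ℬ` and `𝒞` are constant, the terms
  > `det(ℬ), det(𝒞)` drop out of the path integral and thus do not affect Metropolis-Hastings
  > acceptance rates or gradients … The reduced `V/2 × V/2` form of the Dirac operator makes
  > determinant estimation significantly cheaper.
  (§1: `det_eq₁₁`, `det_eq₂₂` — first forms; `det_eq_mixedFree₂₁`, `det_eq_mixedFree₁₂` — second
  forms, proved WITHOUT the invertibility of `𝒜` resp. `𝒟` that the printed chain of equalities
  passes through; `det_mul_det_eq_det_mul_det` — "det(𝒞) drops out" as a division-free identity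
  between two matrices sharing the constant blocks `ℬ, 𝒞`.)
* JLQCD Collaboration (S. Aoki et al.), *Polynomial hybrid Monte Carlo algorithm for lattice QCD with
  an odd number of flavors*, Phys. Rev. D 65 (2002) 094507 = hep-lat/0112051 [AokiEtAl2002PHMC], §3.1
  "Description of the preconditioning" (held text `paper:arxiv-hep-lat_0112051`, chunk p0006):
  > `det[D] = det[[1 + T_ee, M_eo], [M_oe, 1 + T_oo]]` … when the site index is numbered such that
  > even sites come earlier than any odd site … Factoring out the even-even component `(1 + T_ee)` …
  > `det[D] = det[1 + T_ee] det[D̂ᴬ_oo]` where `D̂ᴬ_oo = (1 + T)_oo − M_oe (1 + T)⁻¹_ee M_eo`.  It is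
  > also possible to factor out both the even-even and odd-odd components as
  > `det[D] = det[1 + T_ee] det[1 + T_oo] det[D̂ˢ_oo]` where
  > `D̂ˢ_oo = 1 − (1 + T)⁻¹_oo M_oe (1 + T)⁻¹_ee M_eo` … asymmetric and symmetric preconditioning …
  > [for the unimproved Wilson action the reformulation makes] the pseudofermion field live only on
  > odd sites [Gupta et al. 1989; DeGrand–Rossi 1990].
  (§2: `det_clover_asymmetric`, `det_clover_symmetric`, and the unimproved case `T = 0`:
  `det_wilson_eq_det_odd`, `det_wilson_eq_det_even`, `det_wilson_hopping` — `det(1 − κ²H_oe H_eo)`.)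
* S. Calì, D. C. Hackett, Y. Lin, P. E. Shanahan, B. Xiao, *Neural-network preconditioners for
  solving the Dirac equation in lattice gauge theory*, Phys. Rev. D 107 (2023) 034508 =
  arXiv:2208.02728 [CaliEtAl2023], §6.1 "Even-odd preconditioning" (held text, chunk p0012):
  > `D = [[D_ee, D_eo], [D_oe, D_oo]]` … As long as `D_ee` and `D_oo` can be easily inverted, left and
  > right preconditioners can be defined as `M_L⁻¹ ≡ [[1, −D_eo D_oo⁻¹], [0, 1]]`,
  > `M_R⁻¹ ≡ [[1, 0], [−D_oo⁻¹ D_oe, 1]]`, so that the preconditioned Dirac matrix is block diagonal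
  > `D′ = M_L⁻¹ D M_R⁻¹ = [[D̄_ee, 0], [0, D_oo]]` where `D̄_ee = D_ee − D_eo D_oo⁻¹ D_oe` … `D̄_ee`
  > is simply the Schur complement.
  (§3: `precond_mul_mul_precond` — the display for `D′`; `eq_mul_blockDiagonal_mul` — the converse
  factorisation `D = M_L D′ M_R`; `det_precondL`, `det_precondR` (both `= 1`), `det_eq_det_schur_mul_det`;
  and the solve bookkeeping `mulVec_eq_of_schur_solve`: a solution of the reduced system on the even
  sites plus one application of `D_oo⁻¹` solves `D x = b`.)

## Scope (honest)

Pure `2 × 2` block algebra over a commutative ring `R` for blocks indexed by arbitrary finite types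
`m` (first block) and `n` (second block); "even"/"odd" are only names — nothing about which lattice
sites are even, about sparsity, locality of `(1 + T)_ee⁻¹`, conditioning, or iteration counts (the
"factor of 2–3 reduction in iteration numbers" of [CaliEtAl2023, §6.1] is an empirical statement and
is NOT formalised), and nothing stochastic (the path-integral sentence "det ℬ, det 𝒞 drop out" is
rendered as the algebraic identity `det_mul_det_eq_det_mul_det` between two block matrices with the same
off-diagonal blocks).  Inverses are Mathlib's `Matrix.inv` (`A⁻¹ = Ring.inverse (det A) • adjugate A`),
used only under the stated `IsUnit (det _)` hypotheses.

## References

* [AlbergoEtAl2021Fermions] M. S. Albergo et al., Phys. Rev. D 104 (2021) 114507, App. B (B1)–(B3).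
* [AokiEtAl2002PHMC] JLQCD Collaboration, S. Aoki et al., Phys. Rev. D 65 (2002) 094507, §3.1.
* [CaliEtAl2023] S. Calì et al., Phys. Rev. D 107 (2023) 034508, §6.1.
-/

namespace Literature.LinearAlgebra.Matrix

namespace EvenOdd

open _root_.Matrix

variable {R : Type*} [CommRing R]
variable {m n : Type*} [Fintype m] [Fintype n] [DecidableEq m] [DecidableEq n]

/-! ## §1 Albergo et al. 2021, App. B: the four factorisations of `det [[𝒜, ℬ], [𝒞, 𝒟]]` -/

section Albergo

/-- **(B2), first form**: `det D = det(𝒜) · det(𝒟 − 𝒞 𝒜⁻¹ ℬ)` for an invertible diagonal block `𝒜`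
(Mathlib's `det_fromBlocks₁₁`, restated with `IsUnit (det 𝒜)` and the nonsingular inverse).
[cite: AlbergoEtAl2021Fermions, App. B eq. (B2) (first equality)] -/
theorem det_eq₁₁ (A : Matrix m m R) (B : Matrix m n R) (C : Matrix n m R) (D : Matrix n n R)
    (hA : IsUnit A.det) :
    (fromBlocks A B C D).det = A.det * (D - C * A⁻¹ * B).det := by
  letI := A.invertibleOfIsUnitDet hA
  rw [det_fromBlocks₁₁, invOf_eq_nonsing_inv]

/-- **(B3), first form**: `det D = det(𝒟) · det(𝒜 − ℬ 𝒟⁻¹ 𝒞)` for an invertible diagonal block `𝒟`.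
[cite: AlbergoEtAl2021Fermions, App. B eq. (B3) (first equality)] -/
theorem det_eq₂₂ (A : Matrix m m R) (B : Matrix m n R) (C : Matrix n m R) (D : Matrix n n R)
    (hD : IsUnit D.det) :
    (fromBlocks A B C D).det = D.det * (A - B * D⁻¹ * C).det := by
  letI := D.invertibleOfIsUnitDet hD
  rw [det_fromBlocks₂₂, invOf_eq_nonsing_inv]

variable {ι : Type*} [Fintype ι] [DecidableEq ι]

/-- Row operation used for the mixed-free forms: adding `X ·(second block row)` to the first block
row does not change the determinant. [folklore] -/
private theorem det_rowOp_mul (X : Matrix ι ι R) (M : Matrix (ι ⊕ ι) (ι ⊕ ι) R) :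
    (fromBlocks 1 X 0 1 * M).det = M.det := by
  rw [det_mul, det_fromBlocks_zero₂₁, det_one, one_mul, one_mul]

/-- Column-type operation used for the second mixed-free form. [folklore] -/
private theorem det_rowOp_mul' (Y : Matrix ι ι R) (M : Matrix (ι ⊕ ι) (ι ⊕ ι) R) :
    (fromBlocks 1 0 Y 1 * M).det = M.det := by
  rw [det_mul, det_fromBlocks_zero₁₂, det_one, one_mul, one_mul]

/-- **(B2), second ("mixed-free") form**: for square blocks and an invertible off-diagonal block `𝒞`,
`det D = det(𝒜 𝒞⁻¹ 𝒟 − ℬ) · det(𝒞)` — "the resulting expression does not involve terms that mix `𝒜`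
and `𝒟` with their respective inverses".  The printed derivation passes through the first form (so
through `𝒜⁻¹`); the identity itself needs only `𝒞` invertible, which is how it is proved here (left
multiplication by the unimodular `[[1, (1 − 𝒜)𝒞⁻¹], [0, 1]]`).
[cite: AlbergoEtAl2021Fermions, App. B eq. (B2) (second equality)] -/
theorem det_eq_mixedFree₂₁ (A B C D : Matrix ι ι R) (hC : IsUnit C.det) :
    (fromBlocks A B C D).det = (A * C⁻¹ * D - B).det * C.det := by
  have hCC : C * C⁻¹ = 1 := mul_nonsing_inv C hC
  have hCC' : C⁻¹ * C = 1 := nonsing_inv_mul C hC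
  have key : fromBlocks 1 ((1 - A) * C⁻¹) 0 1 * fromBlocks A B C D =
      fromBlocks 1 (B + (1 - A) * C⁻¹ * D) C D := by
    simp only [fromBlocks_multiply, Matrix.one_mul, Matrix.zero_mul, zero_add, Matrix.mul_assoc, hCC',
      Matrix.mul_one, add_sub_cancel]
  have h := det_rowOp_mul ((1 - A) * C⁻¹) (fromBlocks A B C D)
  rw [key, det_fromBlocks_one₁₁] at h
  rw [← h]
  have : D - C * (B + (1 - A) * C⁻¹ * D) = C * (A * C⁻¹ * D - B) := by
    calc D - C * (B + (1 - A) * C⁻¹ * D)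
        = D - C * B - C * C⁻¹ * D + C * A * C⁻¹ * D := by noncomm_ring
      _ = C * (A * C⁻¹ * D - B) := by rw [hCC]; noncomm_ring
  rw [this, det_mul, mul_comm]

/-- **(B3), second ("mixed-free") form**: for square blocks and an invertible off-diagonal block `ℬ`,
`det D = det(𝒟 ℬ⁻¹ 𝒜 − 𝒞) · det(ℬ)`; only `ℬ` invertible is needed.
[cite: AlbergoEtAl2021Fermions, App. B eq. (B3) (second equality)] -/
theorem det_eq_mixedFree₁₂ (A B C D : Matrix ι ι R) (hB : IsUnit B.det) :
    (fromBlocks A B C D).det = (D * B⁻¹ * A - C).det * B.det := by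
  have hBB : B * B⁻¹ = 1 := mul_nonsing_inv B hB
  have hBB' : B⁻¹ * B = 1 := nonsing_inv_mul B hB
  have key : fromBlocks 1 0 ((1 - D) * B⁻¹) 1 * fromBlocks A B C D =
      fromBlocks A B ((1 - D) * B⁻¹ * A + C) 1 := by
    simp only [fromBlocks_multiply, Matrix.one_mul, Matrix.zero_mul, add_zero, Matrix.mul_assoc, hBB',
      Matrix.mul_one, sub_add_cancel]
  have h := det_rowOp_mul' ((1 - D) * B⁻¹) (fromBlocks A B C D)
  rw [key, det_fromBlocks_one₂₂] at h
  rw [← h]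
  have : A - B * ((1 - D) * B⁻¹ * A + C) = B * (D * B⁻¹ * A - C) := by
    calc A - B * ((1 - D) * B⁻¹ * A + C)
        = A - B * B⁻¹ * A + B * D * B⁻¹ * A - B * C := by noncomm_ring
      _ = B * (D * B⁻¹ * A - C) := by rw [hBB]; noncomm_ring
  rw [this, det_mul, mul_comm]

/-- **"det(ℬ), det(𝒞) drop out"**: two even–odd block matrices with the SAME constant off-diagonal
blocks `ℬ, 𝒞` (two field configurations of the same theory) have determinants in the ratio of their
reduced `V/2 × V/2` determinants `det(𝒜ᵢ𝒞⁻¹𝒟ᵢ − ℬ)` — stated division-free, so that it holds in any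
commutative ring. [cite: AlbergoEtAl2021Fermions, App. B (text after (B3))] -/
theorem det_mul_det_eq_det_mul_det (A₁ D₁ A₂ D₂ B C : Matrix ι ι R) (hC : IsUnit C.det) :
    (fromBlocks A₁ B C D₁).det * (A₂ * C⁻¹ * D₂ - B).det =
      (fromBlocks A₂ B C D₂).det * (A₁ * C⁻¹ * D₁ - B).det := by
  rw [det_eq_mixedFree₂₁ A₁ B C D₁ hC, det_eq_mixedFree₂₁ A₂ B C D₂ hC]
  ring

/-- The same for the `ℬ`-form (B3). [cite: AlbergoEtAl2021Fermions, App. B (text after (B3))] -/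
theorem det_mul_det_eq_det_mul_det' (A₁ D₁ A₂ D₂ B C : Matrix ι ι R) (hB : IsUnit B.det) :
    (fromBlocks A₁ B C D₁).det * (D₂ * B⁻¹ * A₂ - C).det =
      (fromBlocks A₂ B C D₂).det * (D₁ * B⁻¹ * A₁ - C).det := by
  rw [det_eq_mixedFree₁₂ A₁ B C D₁ hB, det_eq_mixedFree₁₂ A₂ B C D₂ hB]
  ring

end Albergo

/-! ## §2 JLQCD 2002, §3.1: asymmetric and symmetric preconditioning of the clover determinant -/

section Clover

/-- **Asymmetric even–odd preconditioning** of the `O(a)`-improved Wilson determinant (even sites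
first): `det[[1 + T_ee, M_eo], [M_oe, 1 + T_oo]] = det(1 + T_ee) · det D̂ᴬ_oo` with
`D̂ᴬ_oo = (1 + T)_oo − M_oe (1 + T)_ee⁻¹ M_eo`, for an invertible local clover block `(1 + T)_ee`.
[cite: AokiEtAl2002PHMC, §3.1 (asymmetric preconditioning, eqs. for det[D] and D̂ᴬ_oo)] -/
theorem det_clover_asymmetric (Tee : Matrix m m R) (Meo : Matrix m n R) (Moe : Matrix n m R)
    (Too : Matrix n n R) (hE : IsUnit (1 + Tee).det) :
    (fromBlocks (1 + Tee) Meo Moe (1 + Too)).det =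
      (1 + Tee).det * ((1 + Too) - Moe * (1 + Tee)⁻¹ * Meo).det :=
  det_eq₁₁ _ _ _ _ hE

/-- **Symmetric even–odd preconditioning**: `det D = det(1 + T_ee) · det(1 + T_oo) · det D̂ˢ_oo` with
`D̂ˢ_oo = 1 − (1 + T)_oo⁻¹ M_oe (1 + T)_ee⁻¹ M_eo`, for invertible clover blocks on both parities
(`D̂ᴬ_oo = (1 + T)_oo · D̂ˢ_oo`).
[cite: AokiEtAl2002PHMC, §3.1 (symmetric preconditioning, eqs. for det[D] and D̂ˢ_oo)] -/
theorem det_clover_symmetric (Tee : Matrix m m R) (Meo : Matrix m n R) (Moe : Matrix n m R)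
    (Too : Matrix n n R) (hE : IsUnit (1 + Tee).det) (hO : IsUnit (1 + Too).det) :
    (fromBlocks (1 + Tee) Meo Moe (1 + Too)).det =
      (1 + Tee).det * (1 + Too).det * (1 - (1 + Too)⁻¹ * Moe * (1 + Tee)⁻¹ * Meo).det := by
  rw [det_clover_asymmetric Tee Meo Moe Too hE, mul_assoc, ← det_mul]
  congr 2
  rw [Matrix.mul_sub, Matrix.mul_one]
  simp only [Matrix.mul_assoc]
  rw [← Matrix.mul_assoc (1 + Too) (1 + Too)⁻¹, mul_nonsing_inv _ hO, Matrix.one_mul]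

/-- **Unimproved Wilson fermions (`T = 0`)**: `det[[1, M_eo], [M_oe, 1]] = det(1 − M_oe M_eo)` — the
determinant is that of the reduced operator on the ODD sites only ("the pseudofermion field lives only
on odd sites"), at no extra cost. [cite: AokiEtAl2002PHMC, §3.1 (the unimproved case, refs. Gupta et
al. 1989 / DeGrand–Rossi 1990)] -/
theorem det_wilson_eq_det_odd (Meo : Matrix m n R) (Moe : Matrix n m R) :
    (fromBlocks 1 Meo Moe 1).det = (1 - Moe * Meo).det :=
  det_fromBlocks_one₁₁ _ _ _

/-- The same determinant as that of the reduced operator on the EVEN sites, `det(1 − M_eo M_oe)`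
(Weinstein–Aronszajn). [cite: AokiEtAl2002PHMC, §3.1 (the unimproved case)] -/
theorem det_wilson_eq_det_even (Meo : Matrix m n R) (Moe : Matrix n m R) :
    (fromBlocks 1 Meo Moe 1).det = (1 - Meo * Moe).det := by
  rw [det_wilson_eq_det_odd, det_one_sub_mul_comm]

/-- Hopping-parameter form: with `M = −κH` (`H` the hopping matrix, which connects only sites of
opposite parity), `det(1 − κH) = det(1 − κ² H_oe H_eo)` — the determinant is a function of `κ²` through
the reduced operator. [cite: AokiEtAl2002PHMC, §3.1 (eq. for M_{n,n'} = −κ Σ_μ …, unimproved case)] -/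
theorem det_wilson_hopping (κ : R) (Heo : Matrix m n R) (Hoe : Matrix n m R) :
    (fromBlocks 1 (-(κ • Heo)) (-(κ • Hoe)) 1).det = (1 - κ ^ 2 • (Hoe * Heo)).det := by
  rw [det_wilson_eq_det_odd, Matrix.neg_mul, Matrix.mul_neg, neg_neg, Matrix.smul_mul,
    Matrix.mul_smul, smul_smul, sq]

end Clover

/-! ## §3 Calì et al. 2023, §6.1: the block-diagonal preconditioned matrix `M_L⁻¹ D M_R⁻¹` -/

section Precond

/-- Block LDU factorisation `D = M_L · D′ · M_R` with `M_L = [[1, D_eo D_oo⁻¹], [0, 1]]`,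
`D′ = [[D̄_ee, 0], [0, D_oo]]`, `M_R = [[1, 0], [D_oo⁻¹ D_oe, 1]]`, `D̄_ee = D_ee − D_eo D_oo⁻¹ D_oe` the
Schur complement, for an invertible `D_oo` (Mathlib's `fromBlocks_eq_of_invertible₂₂` with the
nonsingular inverse). [cite: CaliEtAl2023, §6.1 (D′ = M_L⁻¹ D M_R⁻¹ and D̄_ee)] -/
theorem eq_mul_blockDiagonal_mul (Dee : Matrix m m R) (Deo : Matrix m n R) (Doe : Matrix n m R)
    (Doo : Matrix n n R) (hO : IsUnit Doo.det) :
    fromBlocks Dee Deo Doe Doo =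
      fromBlocks 1 (Deo * Doo⁻¹) 0 1 * fromBlocks (Dee - Deo * Doo⁻¹ * Doe) 0 0 Doo *
        fromBlocks 1 0 (Doo⁻¹ * Doe) 1 := by
  letI := Doo.invertibleOfIsUnitDet hO
  rw [← invOf_eq_nonsing_inv]
  exact fromBlocks_eq_of_invertible₂₂ Dee Deo Doe Doo

/-- Block upper unitriangular matrices multiply by adding their corners. [folklore] -/
private theorem upper_mul_upper (X Y : Matrix m n R) :
    fromBlocks (1 : Matrix m m R) X 0 (1 : Matrix n n R) * fromBlocks 1 Y 0 1 =
      fromBlocks 1 (X + Y) 0 1 := by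
  simp only [fromBlocks_multiply, Matrix.one_mul, Matrix.mul_one, Matrix.zero_mul, Matrix.mul_zero,
    add_zero, zero_add, add_comm X Y]

/-- Block lower unitriangular matrices multiply by adding their corners. [folklore] -/
private theorem lower_mul_lower (X Y : Matrix n m R) :
    fromBlocks (1 : Matrix m m R) 0 X (1 : Matrix n n R) * fromBlocks 1 0 Y 1 =
      fromBlocks 1 0 (X + Y) 1 := by
  simp only [fromBlocks_multiply, Matrix.one_mul, Matrix.mul_one, Matrix.zero_mul, Matrix.mul_zero,
    add_zero, zero_add]

/-- **The even–odd preconditioned Dirac matrix is block diagonal**: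
`[[1, −D_eo D_oo⁻¹], [0, 1]] · D · [[1, 0], [−D_oo⁻¹ D_oe, 1]] = [[D̄_ee, 0], [0, D_oo]]` with the Schur
complement `D̄_ee = D_ee − D_eo D_oo⁻¹ D_oe`, for an invertible `D_oo`.
[cite: CaliEtAl2023, §6.1 (eqs. for M_L⁻¹, M_R⁻¹ and D′ = M_L⁻¹ D M_R⁻¹)] -/
theorem precond_mul_mul_precond (Dee : Matrix m m R) (Deo : Matrix m n R) (Doe : Matrix n m R)
    (Doo : Matrix n n R) (hO : IsUnit Doo.det) :
    fromBlocks 1 (-(Deo * Doo⁻¹)) 0 1 * fromBlocks Dee Deo Doe Doo * fromBlocks 1 0 (-(Doo⁻¹ * Doe)) 1 =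
      fromBlocks (Dee - Deo * Doo⁻¹ * Doe) 0 0 Doo := by
  rw [eq_mul_blockDiagonal_mul Dee Deo Doe Doo hO]
  calc fromBlocks 1 (-(Deo * Doo⁻¹)) 0 1 *
        (fromBlocks 1 (Deo * Doo⁻¹) 0 1 * fromBlocks (Dee - Deo * Doo⁻¹ * Doe) 0 0 Doo *
          fromBlocks 1 0 (Doo⁻¹ * Doe) 1) * fromBlocks 1 0 (-(Doo⁻¹ * Doe)) 1
      = (fromBlocks 1 (-(Deo * Doo⁻¹)) 0 1 * fromBlocks 1 (Deo * Doo⁻¹) 0 1) *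
          fromBlocks (Dee - Deo * Doo⁻¹ * Doe) 0 0 Doo *
          (fromBlocks 1 0 (Doo⁻¹ * Doe) 1 * fromBlocks 1 0 (-(Doo⁻¹ * Doe)) 1) := by
        simp only [Matrix.mul_assoc]
    _ = fromBlocks (Dee - Deo * Doo⁻¹ * Doe) 0 0 Doo := by
        rw [upper_mul_upper, lower_mul_lower, neg_add_cancel, add_neg_cancel, fromBlocks_one,
          Matrix.one_mul, Matrix.mul_one]

/-- The left preconditioner is unimodular: `det M_L⁻¹ = 1`. [cite: CaliEtAl2023, §6.1 (M_L⁻¹)] -/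
theorem det_precondL (X : Matrix m n R) : (fromBlocks 1 X 0 (1 : Matrix n n R)).det = 1 := by
  rw [det_fromBlocks_zero₂₁, det_one, det_one, mul_one]

/-- The right preconditioner is unimodular: `det M_R⁻¹ = 1`. [cite: CaliEtAl2023, §6.1 (M_R⁻¹)] -/
theorem det_precondR (Y : Matrix n m R) : (fromBlocks (1 : Matrix m m R) 0 Y 1).det = 1 := by
  rw [det_fromBlocks_zero₁₂, det_one, det_one, mul_one]

/-- Hence `det D = det D′ = det D̄_ee · det D_oo`: the preconditioned and the original matrix have the
same determinant. [cite: CaliEtAl2023, §6.1 (D′ and the Schur complement D̄_ee)] -/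
theorem det_eq_det_schur_mul_det (Dee : Matrix m m R) (Deo : Matrix m n R) (Doe : Matrix n m R)
    (Doo : Matrix n n R) (hO : IsUnit Doo.det) :
    (fromBlocks Dee Deo Doe Doo).det = (Dee - Deo * Doo⁻¹ * Doe).det * Doo.det := by
  rw [det_eq₂₂ _ _ _ _ hO, mul_comm]

omit [DecidableEq m] in
/-- **Solve bookkeeping**: to solve `D x = b` (`b = (b_e, b_o)`) it suffices to solve the reduced
system `D̄_ee x_e = b_e − D_eo D_oo⁻¹ b_o` on the even sites and to back-substitute
`x_o = D_oo⁻¹ (b_o − D_oe x_e)` — one solve of the `V/2 × V/2` Schur complement plus applications of the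
inverse of the site-diagonal block (the normal equation of [CaliEtAl2023, §6.1] is then CG on
`D̄_ee† D̄_ee`). [cite: CaliEtAl2023, §6.1 (CG on A′ = D̄_ee† D̄_ee after preconditioning)] -/
theorem mulVec_eq_of_schur_solve (Dee : Matrix m m R) (Deo : Matrix m n R) (Doe : Matrix n m R)
    (Doo : Matrix n n R) (hO : IsUnit Doo.det) (be xe : m → R) (bo : n → R)
    (hxe : (Dee - Deo * Doo⁻¹ * Doe) *ᵥ xe = be - Deo *ᵥ (Doo⁻¹ *ᵥ bo)) :
    fromBlocks Dee Deo Doe Doo *ᵥ Sum.elim xe (Doo⁻¹ *ᵥ (bo - Doe *ᵥ xe)) = Sum.elim be bo := by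
  have h1 : Doo * Doo⁻¹ = 1 := mul_nonsing_inv Doo hO
  rw [fromBlocks_mulVec, Sum.elim_comp_inl, Sum.elim_comp_inr]
  congr 1
  · rw [Matrix.sub_mulVec, ← Matrix.mulVec_mulVec, ← Matrix.mulVec_mulVec] at hxe
    rw [Matrix.mulVec_sub, Matrix.mulVec_sub]
    linear_combination hxe
  · rw [Matrix.mulVec_mulVec, h1, Matrix.one_mulVec, add_sub_cancel]

end Precond

end EvenOdd

end Literature.LinearAlgebra.Matrix
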